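import Summits.CriticalPhenomena.SAWScalingLimit.Theorems.SAWLoopFugacityFlowIsingBoundaryRatioWindowRectDefs
import Summits.CriticalPhenomena.SAWScalingLimit.Theorems.SAWLoopFugacityFlowIsingBoundaryRatioWindowRectChart
import HarnessLib

/-!
# The static setting of the window-rectangle construction
(line `fk-anchor-transfer`, crux `IsingBoundaryRatio`, stmt-CriticalPhenomena-10650; helper file of the stub
`windowRectPresentation_holds : WindowRectPresentation`)

The proof of `WindowRectPresentation` (`…WindowRectDefs`) fixes, inside the eventual quantifier in the mesh `δ`,
a long list of data and smallness conditions: the Dobrushin domain `D` with its chordal chart `φ`, the chart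
extension `g` and the straightening homeomorphism `H` of `…WindowRectChart`, the radii
`ρ < r₁ < r₁' < r₂' < r₂ < Mρ`, a margin `m`, the chart oscillation `κ` over `2δ` (uniform continuity of `g`
away from `b`), the finite volume `Λ`, a bulk base site `z₀`, the lattice-shadowing property of chart paths
in a compact bulk region, and the separation constant of the outside routes (`…WindowRectRoutesSep`). This
module BUNDLES them in one structure `WSetting` (a Type, carrying data and hypotheses; no proposition is
asserted), so that the dozen proof files of the construction share one context `X : WSetting`, and records
the elementary consequences (the inner / outer chart cuts `w₁ = r₁ + 4m`, `w₂ = r₂ - 4m`, chart radius of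
sites, the oscillation of the chart between nearby points of `closure D`). The final assembly
(`…WindowRectPresentation`) constructs a `WSetting` from the hypotheses of `WindowRectPresentation`. [folklore]
-/

noncomputable section

open scoped Classical Topology Real
open Filter Set Metric Complex
open Literature.Probability.LatticeModels Literature.Probability.RandomPlanarGeometry
open Literature.Probability.LatticeModels.DiscreteRect
open UpperHalfPlane (upperHalfPlaneSet)

namespace Summit.CriticalPhenomena.SAWScalingLimit.Theorems.IsingBoundaryRatio

namespace WindowRect

/-- **The static setting** of the window-rectangle construction (see the module docstring). [folklore] -/
structure WSetting where
  /-- the Dobrushin domain `(D; a, b)` -/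
  D : DobrushinDomain
  /-- its chordal chart -/
  φ : ConformalEquiv upperHalfPlaneSet D.carrier
  /-- the modulus parameter, the localisation radius, the scale -/
  (M ε ρ : ℝ)
  /-- the window radii and the margin -/
  (r₁ r₁' r₂' r₂ m : ℝ)
  /-- the mesh and the chart oscillation -/
  (δ κ : ℝ)
  /-- the finite volume -/
  Λ : Finset (Site 2)
  /-- the chart extension and the straightening homeomorphism -/
  g : ℂ → ℂ
  H : ℂ ≃ₜ ℂ
  /-- distance from `b` kept by points of chart radius `≤ r₂ + m` -/
  d : ℝ
  /-- the bulk base site -/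
  z₀ : Site 2
  /-- the radial increments of the chart over one lattice step in the bulk region -/
  (cstar Cstar : ℝ)
  /-- the angular margin and the planar separation of the outside routes -/
  (θ₀ η : ℝ)
  hρ : 0 < ρ
  hρr₁ : ρ < r₁
  hr₂ : r₂ < M * ρ
  hm : 0 < m
  hr₁ : r₁ + 8 * m ≤ r₁'
  hr₁₂ : r₁' < r₂'
  hr₂' : r₂' + 8 * m ≤ r₂
  hδ : 0 < δ
  hκ : 0 < κ
  hκm : 100 * κ ≤ m
  /-- chart package (`…WindowRectChart.exists_chart_package`) -/
  hg_cont : ContinuousOn g (closure D.carrier \ {D.pt 1})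
  hg_eq : EqOn g φ.symm D.carrier
  hg_real : ∀ z ∈ frontier D.carrier, z ≠ D.pt 1 → (g z).im = 0
  hg_inj : InjOn g (closure D.carrier \ {D.pt 1})
  hg_zero : g (D.pt 0) = 0
  hH : ∀ z, z ∈ closure D.carrier ↔ ‖H z‖ ≤ 1
  hH_fr : ∀ z ∈ frontier D.carrier, z ≠ D.pt 1 → H z = exp ((π + 2 * Real.arctan (g z).re : ℝ) * I)
  /-- far from `b` -/
  hd : 0 < d
  hfar : ∀ z ∈ D.carrier, ‖φ.symm z‖ ≤ r₂ + m → d ≤ dist z (D.pt 1)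
  hδd : 8 * δ ≤ d
  /-- chart oscillation over `2δ` -/
  hmod : ∀ z ∈ closure D.carrier, ∀ z' ∈ closure D.carrier, d / 2 ≤ dist z (D.pt 1) → dist z z' ≤ 2 * δ →
    dist (g z) (g z') ≤ κ
  /-- small chart radius means close to `a` -/
  hball : ∀ z ∈ D.carrier, ‖φ.symm z‖ < M * ρ → z ∈ ball (D.pt 0) ε
  /-- the volume contains the chart disc -/
  hΛ : ∀ x ∈ meshDomain D.carrier δ, ‖φ.symm (meshPoint δ x)‖ < M * ρ → x ∈ Λ
  /-- the base site: a vertex of `Ω_δ` with chart point near `i (r₁' + r₂')/2` -/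
  hz₀ : z₀ ∈ meshDomain D.carrier δ
  hz₀c : dist (φ.symm (meshPoint δ z₀)) ((((r₁' + r₂') / 2 : ℝ) : ℂ) * I) ≤ κ
  /-- the bulk region `r₁ + m ≤ |w| ≤ r₂ - m`, `im w ≥ (r₁ + 4m)/20` of the chart is drawn well inside `D` -/
  hbulk : ∀ w : ℂ, r₁ + m ≤ ‖w‖ → ‖w‖ ≤ r₂ - m → (r₁ + 4 * m) / 20 ≤ w.im → closedBall (φ w) (2 * δ) ⊆ D.carrier
  /-- lattice shadowing of chart paths in the bulk region -/
  hshadow : ∀ (z z' : Site 2) (hz : meshPoint δ z ∈ D.carrier) (hz' : meshPoint δ z' ∈ D.carrier)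
    (γ : Path (φ.symm (meshPoint δ z)) (φ.symm (meshPoint δ z'))),
    (∀ t, r₁ + m ≤ ‖γ t‖ ∧ ‖γ t‖ ≤ r₂ - m ∧ (r₁ + 4 * m) / 20 ≤ (γ t).im) →
    ∃ W : (meshGraph D.carrier δ).Walk z z', ∀ s ∈ W.support, meshPoint δ s ∈ D.carrier ∧
      ∃ t, dist (φ.symm (meshPoint δ s)) (γ t) ≤ κ
  /-- one lattice step in the bulk region moves the chart point by at most `C⋆ δ`, and some step increases,
  some step decreases, the chart radius by at least `c⋆ δ` -/
  hc : 0 < cstar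
  hcC : cstar ≤ Cstar
  hδC : Cstar * δ ≤ κ
  hκstep : 100 * κ * Cstar ≤ cstar * m
  hstep : ∀ x : Site 2, meshPoint δ x ∈ D.carrier → r₁ + m ≤ ‖φ.symm (meshPoint δ x)‖ →
    ‖φ.symm (meshPoint δ x)‖ ≤ r₂ - m → (r₁ + 4 * m) / 20 ≤ (φ.symm (meshPoint δ x)).im →
    (∀ k : Fin 4, meshPoint δ (x + dir k) ∈ D.carrier ∧
      dist (φ.symm (meshPoint δ (x + dir k))) (φ.symm (meshPoint δ x)) ≤ Cstar * δ) ∧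
    (∃ k : Fin 4, ‖φ.symm (meshPoint δ x)‖ + cstar * δ ≤ ‖φ.symm (meshPoint δ (x + dir k))‖) ∧
    (∃ k : Fin 4, ‖φ.symm (meshPoint δ (x + dir k))‖ ≤ ‖φ.symm (meshPoint δ x)‖ - cstar * δ)
  /-- the angular margin of the boundary angle `θ(u) = π + 2 arctan u` over parameter gaps `≥ m/2` -/
  hθ₀ : 0 < θ₀
  hθ₀π : θ₀ ≤ π
  hθ₀sep : ∀ u v : ℝ, |u| ≤ r₂ + m → |v| ≤ r₂ + m → m / 2 ≤ |u - v| →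
    θ₀ ≤ |(π + 2 * Real.arctan u) - (π + 2 * Real.arctan v)| ∧
      |(π + 2 * Real.arctan u) - (π + 2 * Real.arctan v)| ≤ 2 * π - θ₀
  /-- the planar separation of the outside routes (`…WindowRectRoutesSep.exists_sep_routes`) -/
  hη : 0 < η
  hδη : 2 * δ < η
  hsep : ∀ (p₁ q₁ p₂ q₂ : ℂ) (α₁ β₁ α₂ β₂ : ℝ),
    H p₁ = circleMap 0 1 α₁ → H q₁ = circleMap 0 1 β₁ → H p₂ = circleMap 0 1 α₂ → H q₂ = circleMap 0 1 β₂ →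
    (∀ φ', (φ' = α₁ ∨ φ' = β₁) → ∀ φ'', (φ'' = α₂ ∨ φ'' = β₂) → θ₀ ≤ |φ' - φ''| ∧ |φ' - φ''| ≤ 2 * π - θ₀) →
    (∀ θ ∈ uIcc α₁ β₁, ∀ φ'', (φ'' = α₂ ∨ φ'' = β₂) → θ₀ ≤ |θ - φ''| ∧ |θ - φ''| ≤ 2 * π - θ₀) →
    ∃ (A : Path p₁ q₁) (B : Path p₂ q₂),
      (∀ z ∈ range A, z ∉ closure D.carrier ∨ z = p₁ ∨ z = q₁) ∧
      (∀ z ∈ range B, z ∉ closure D.carrier ∨ z = p₂ ∨ z = q₂) ∧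
      ∀ z ∈ range A, ∀ z' ∈ range B, η ≤ dist z z'

namespace WSetting

variable (X : WSetting)

/-! ### The chart cuts and elementary inequalities -/

/-- The inner chart cut `w₁ = r₁ + 4m`. [folklore] -/
def w₁ : ℝ := X.r₁ + 4 * X.m

/-- The outer chart cut `w₂ = r₂ - 4m`. [folklore] -/
def w₂ : ℝ := X.r₂ - 4 * X.m

/-- The base radius `r⋆ = (r₁' + r₂')/2`. [folklore] -/
def rstar : ℝ := (X.r₁' + X.r₂') / 2

/-- The floor `h⋆ = w₁ / 20` of the imaginary part in the bulk region. [folklore] -/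
def hstar : ℝ := X.w₁ / 20

/-- `w₁` unfolded. [folklore] -/
theorem w₁_def : X.w₁ = X.r₁ + 4 * X.m := rfl
/-- `w₂` unfolded. [folklore] -/
theorem w₂_def : X.w₂ = X.r₂ - 4 * X.m := rfl
/-- `r⋆` unfolded. [folklore] -/
theorem rstar_def : X.rstar = (X.r₁' + X.r₂') / 2 := rfl
/-- `h⋆` unfolded. [folklore] -/
theorem hstar_def : X.hstar = X.w₁ / 20 := rfl
/-- `h⋆` in terms of `r₁, m`. [folklore] -/
theorem hstar_eq : X.hstar = (X.r₁ + 4 * X.m) / 20 := rfl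

/-- `0 < r₁`. [folklore] -/
theorem r₁_pos : 0 < X.r₁ := X.hρ.trans X.hρr₁

/-- The chain of radii `0 < r₁ < w₁ ≤ r₁' - 4m < r₁' < r₂' < r₂' + 4m ≤ w₂ < r₂`. [folklore] -/
theorem radii : 0 < X.r₁ ∧ X.r₁ < X.w₁ ∧ X.w₁ + 4 * X.m ≤ X.r₁' ∧ X.r₁' < X.r₂' ∧ X.r₂' + 4 * X.m ≤ X.w₂ ∧
    X.w₂ < X.r₂ := by
  have := X.hm; have := X.hr₁; have := X.hr₁₂; have := X.hr₂'
  exact ⟨X.r₁_pos, by rw [w₁_def]; linarith, by rw [w₁_def]; linarith, X.hr₁₂, by rw [w₂_def]; linarith,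
    by rw [w₂_def]; linarith⟩

/-- `κ ≤ m / 100` and `0 < κ`. [folklore] -/
theorem κ_le : X.κ ≤ X.m / 100 ∧ 0 < X.κ := ⟨by linarith [X.hκm], X.hκ⟩

/-! ### Points of the domain and the chart -/

/-- `b ∉ D`. [folklore] -/
theorem pt_one_not_mem : X.D.pt 1 ∉ X.D.carrier := fun h => by
  have := X.D.pt_mem_frontier 1
  rw [X.D.isOpen.frontier_eq] at this
  exact this.2 h

/-- On `D` the chart extension is the inverse chart. [folklore] -/
theorem g_eq {z : ℂ} (hz : z ∈ X.D.carrier) : X.g z = X.φ.symm z := X.hg_eq hz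

/-- Points of `D` have chart points in the upper half-plane. [folklore] -/
theorem im_pos {z : ℂ} (hz : z ∈ X.D.carrier) : 0 < (X.φ.symm z).im := X.φ.symm_mapsTo hz

/-- A point of `D` of chart radius `≤ r₂ + m` is at distance `≥ d` from `b`. [folklore] -/
theorem far {z : ℂ} (hz : z ∈ X.D.carrier) (hzr : ‖X.φ.symm z‖ ≤ X.r₂ + X.m) : X.d ≤ dist z (X.D.pt 1) :=
  X.hfar z hz hzr

/-- **Chart oscillation.** For `z ∈ D` of chart radius `≤ r₂ + m` and `z' ∈ closure D` within `2δ`: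
`dist (g z') (φ⁻¹ z) ≤ κ`. [folklore] -/
theorem osc {z z' : ℂ} (hz : z ∈ X.D.carrier) (hzr : ‖X.φ.symm z‖ ≤ X.r₂ + X.m) (hz' : z' ∈ closure X.D.carrier)
    (hd : dist z z' ≤ 2 * X.δ) : dist (X.g z') (X.φ.symm z) ≤ X.κ := by
  rw [← X.g_eq hz, _root_.dist_comm]
  exact X.hmod z (subset_closure hz) z' hz' (by linarith [X.far hz hzr, X.hd]) hd

/-- The same for two points of `D`. [folklore] -/
theorem osc' {z z' : ℂ} (hz : z ∈ X.D.carrier) (hzr : ‖X.φ.symm z‖ ≤ X.r₂ + X.m) (hz' : z' ∈ X.D.carrier)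
    (hd : dist z z' ≤ 2 * X.δ) : dist (X.φ.symm z') (X.φ.symm z) ≤ X.κ := by
  rw [← X.g_eq hz']; exact X.osc hz hzr (subset_closure hz') hd

/-- Mesh points of lattice neighbours are `δ` apart. [folklore] -/
theorem dist_meshPoint_adj {x y : Site 2} (h : (zdGraph 2).Adj x y) : dist (meshPoint X.δ x) (meshPoint X.δ y) = X.δ := by
  have := Literature.Probability.Percolation.dist_meshPoint_of_adj (δ := X.δ) h
  rwa [abs_of_pos X.hδ] at this

/-- Mesh points of `x` and `x + e_k + e_{k'}`-type second neighbours are within `2δ`. [folklore] -/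
theorem dist_meshPoint_le_two {x y z : Site 2} (h : (zdGraph 2).Adj x y) (h' : (zdGraph 2).Adj y z) :
    dist (meshPoint X.δ x) (meshPoint X.δ z) ≤ 2 * X.δ := by
  have h1 := X.dist_meshPoint_adj h
  have h2 := X.dist_meshPoint_adj h'
  linarith [dist_triangle (meshPoint X.δ x) (meshPoint X.δ y) (meshPoint X.δ z)]

/-! ### Sites: chart radius, the volume, the ball -/

/-- The chart radius of a site (junk outside `D`). [folklore] -/
def rad (x : Site 2) : ℝ := ‖X.φ.symm (meshPoint X.δ x)‖

/-- `rad` unfolded. [folklore] -/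
theorem rad_def (x : Site 2) : X.rad x = ‖X.φ.symm (meshPoint X.δ x)‖ := rfl

/-- Sites of `Ω_δ` have mesh points in `D`. [folklore] -/
theorem meshPoint_mem {x : Site 2} (hx : x ∈ meshDomain X.D.carrier X.δ) : meshPoint X.δ x ∈ X.D.carrier :=
  meshDomain_subset_meshVertices _ _ hx

/-- A site of `Ω_δ` of chart radius `≤ r₂` is in the volume `Λ`. [folklore] -/
theorem mem_Λ {x : Site 2} (hx : x ∈ meshDomain X.D.carrier X.δ) (hr : X.rad x ≤ X.r₂) : x ∈ X.Λ :=
  X.hΛ x hx (hr.trans_lt X.hr₂)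

/-- A point of `D` of chart radius `≤ r₂` is in the ball `B(a, ε)`. [folklore] -/
theorem mem_ball {z : ℂ} (hz : z ∈ X.D.carrier) (hr : ‖X.φ.symm z‖ ≤ X.r₂) : z ∈ ball (X.D.pt 0) X.ε :=
  X.hball z hz (hr.trans_lt X.hr₂)

/-- **Chart radii of mesh-adjacent sites differ by at most `κ`** (sites of `D`, the first of chart radius
`≤ r₂ + m`). [folklore] -/
theorem abs_rad_sub_rad_le {x y : Site 2} (hx : meshPoint X.δ x ∈ X.D.carrier) (hy : meshPoint X.δ y ∈ X.D.carrier)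
    (hxy : (zdGraph 2).Adj x y) (hr : X.rad x ≤ X.r₂ + X.m) : |X.rad y - X.rad x| ≤ X.κ := by
  rw [rad_def, rad_def]
  refine (abs_norm_sub_norm_le _ _).trans ?_
  rw [← dist_eq_norm]
  exact X.osc' hx hr hy (by rw [X.dist_meshPoint_adj hxy]; linarith [X.hδ])

end WSetting

end WindowRect

/-- The inner chart cut lies below the inner window: `w₁ + 4m ≤ r₁'` (registered sub-goal of
stmt-CriticalPhenomena-10650, anchoring this settings module). [folklore] -/
theorem windowRect_wone_add_le : ∀ (X : WindowRect.WSetting), X.w₁ + 4 * X.m ≤ X.r₁' :=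
  fun X => X.radii.2.2.1

end Summit.CriticalPhenomena.SAWScalingLimit.Theorems.IsingBoundaryRatio

end
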